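import Mathlib
import Summits.MatrixMultiplication.MatrixMultiplication.Theses.SnSubsetDichotomy
import Summits.MatrixMultiplication.MatrixMultiplication.Theorems.SnSubsetDichotomyJuntaBranchStubRegularity

/-!
# `JuntaBranch ⇒ WindowRegularity`: the partial-slice necessary condition
(crux stmt-MatrixMultiplication-8304; statement `PartialSliceNecessity` / `WindowRegularity` of
round-2 ideator 4, `Cruxes/JuntaBranch/SketchIdeator4.lean`, memo §4 lemma L1)

PARTIAL SLICING.  In a TPP triple `(S,T,U)` of `S_n` fix the target point `0`, let `i` be a source
whose atom `A = {σ ∈ S | σ i = 0}` is heaviest (`|S| ≤ n|A|`, `JuntaBranch.exists_heavy_atom`) and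
keep, besides `A`, as many further elements of `S` as possible subject to `|S'| < |A|·n^{1/2-ε}`:
`A ⊆ S' ⊆ S`, `|S'| = min |S| (⌈|A| n^{1/2-ε}⌉ - 1)`.  Then `(S',T,U)` is TPP (heredity),
`|S| ≤ 2 n^{1/2+ε} |S'|` (either `S' = S`, or `|S'| ≥ |A| n^{1/2-ε}/2 ≥ |S| n^{-1/2-ε}/2`), and
`S'` carries an `ε`-super-neutral bump at level `1`: `n^{1/2+ε}|S'| < n·|A| = |S' ∩ U_{i→0}|·n^{(1)}`.
So if `|S||T||U| ≥ 4n^{1/2+ε}(n!)^{3/2}e^{-c√n}` the slice is `Large(c)` and bumpy, and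
`JuntaBranch ε c` applied to it yields a TPP triple in the window `[n-√n, n)` with
`e^{c+1}|S||T||U|(n'!/n!)^{3/2} ≤ 2n^{1/2+ε}·|S''||T''||U''|`.

`juntaBranch_imp_windowRegularity : JuntaBranch → ∀ ε ∈ (0, 1/2), ∀ c > 0, WindowRegularity ε c`
(with the memo's constant `4`) is therefore a necessary condition every proof of the filed crux
must meet: at each `c`, the normalised extremal function `F(m) = maxVol(m)/(m!)^{3/2}` cannot drop
by more than the factor `4n^{1/2+ε}e^{-(c+1)}` from a `Large` level `n` to the best level of its
window.  It sharpens the sliced shadow `juntaBranch_imp_slicedShadow` (factor `n`, and `c' < c`)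
to the factor `4n^{1/2+ε}` at the same `c`.  Def-free statement (the memo's `WindowRegularity ε c`
used verbatim, inlined).
-/

set_option linter.dupNamespace false

open Literature.Combinatorics.Additive
open Summit.MatrixMultiplication.MatrixMultiplication.Theses.SnSubsetDichotomy
open scoped Classical

namespace Summit.MatrixMultiplication.MatrixMultiplication.Theorems.JuntaBranch

/-- **Partial slice.**  For `0 < ε < 1/2`, `n ≥ 2`, a target `l` and a non-empty `S ⊆ S_n` there
are a source `i` and a sub-family `S' ⊆ S` with `|S| ≤ 2n^{1/2+ε}|S'|` whose atom at `(i → l)`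
is `ε`-super-neutral at level `1`: `n^{1/2+ε}|S'| < n·|{σ ∈ S' | σ i = l}|`. [folklore] -/
theorem exists_partialSlice {n : ℕ} (hn : 2 ≤ n) {ε : ℝ} (hε : 0 < ε) (hε2 : ε < 1 / 2)
    (l : Fin n) (S : Finset (Equiv.Perm (Fin n))) (hS : S.Nonempty) :
    ∃ i : Fin n, ∃ S' : Finset (Equiv.Perm (Fin n)), S' ⊆ S ∧
      (S.card : ℝ) ≤ 2 * (n : ℝ) ^ (1 / 2 + ε) * (S'.card : ℝ) ∧
      (n : ℝ) ^ (1 / 2 + ε) * (S'.card : ℝ) < (n : ℝ) * ((S'.filter (fun σ => σ i = l)).card : ℝ) := by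
  obtain ⟨i, hi⟩ := exists_heavy_atom l S
  set A : Finset (Equiv.Perm (Fin n)) := S.filter (fun σ => σ i = l) with hA
  have hAS : A ⊆ S := Finset.filter_subset _ _
  have hSpos : 0 < S.card := Finset.card_pos.2 hS
  have hApos : 0 < A.card := Nat.pos_of_mul_pos_left (lt_of_lt_of_le hSpos hi)
  have hn0 : (0 : ℝ) < n := by exact_mod_cast (lt_of_lt_of_le (by norm_num) hn)
  have hn1 : (1 : ℝ) < n := by exact_mod_cast (lt_of_lt_of_le (by norm_num) hn)
  -- the two powers of `n`
  set P : ℝ := (n : ℝ) ^ (1 / 2 + ε) with hP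
  set Q : ℝ := (n : ℝ) ^ (1 / 2 - ε) with hQ
  have hP0 : 0 < P := Real.rpow_pos_of_pos hn0 _
  have hQ1 : 1 < Q := Real.one_lt_rpow hn1 (by linarith)
  have hPQ : P * Q = n := by
    rw [hP, hQ, ← Real.rpow_add hn0]
    norm_num
  -- the size cap `x = |A|·n^{1/2-ε}` and the target size
  set x : ℝ := (A.card : ℝ) * Q with hx
  have hAR : (0 : ℝ) < A.card := by exact_mod_cast hApos
  have hA1 : (1 : ℝ) ≤ A.card := by exact_mod_cast hApos
  have hax : (A.card : ℝ) < x := by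
    rw [hx]; exact lt_mul_right hAR hQ1
  have hx0 : 0 ≤ x := le_of_lt (lt_of_lt_of_le' hax hAR.le)
  set M : ℕ := ⌈x⌉₊ - 1 with hM
  have hceil1 : 1 ≤ ⌈x⌉₊ := Nat.one_le_iff_ne_zero.2 (by
    intro h0
    rw [Nat.ceil_eq_zero] at h0
    linarith)
  have hMR : (M : ℝ) = (⌈x⌉₊ : ℝ) - 1 := by
    rw [hM, Nat.cast_sub hceil1, Nat.cast_one]
  have hMlt : (M : ℝ) < x := by
    rw [hMR]; linarith [Nat.ceil_lt_add_one hx0]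
  have hAM : A.card ≤ M := by
    have h1 : A.card < ⌈x⌉₊ := Nat.lt_ceil.2 hax
    rw [hM]; omega
  have hMx : x ≤ 2 * (M : ℝ) := by
    have hMge : x - 1 ≤ (M : ℝ) := by rw [hMR]; linarith [Nat.le_ceil x]
    have hAM' : (A.card : ℝ) ≤ M := by exact_mod_cast hAM
    rcases le_or_gt x (2 * A.card) with h | h
    · linarith
    · linarith
  set m : ℕ := min S.card M with hm
  have hmS : m ≤ S.card := min_le_left _ _
  have hmM : m ≤ M := min_le_right _ _
  have hAm : A.card ≤ m := le_min (Finset.card_le_card hAS) hAM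
  obtain ⟨S', hAS', hS'S, hcard⟩ := Finset.exists_subsuperset_card_eq hAS hAm hmS
  refine ⟨i, S', hS'S, ?_, ?_⟩
  · -- |S| ≤ 2 n^{1/2+ε} |S'|
    rw [hcard]
    rcases min_choice S.card M with hmin | hmin
    · rw [hm, hmin]
      have hSR : (0 : ℝ) ≤ S.card := Nat.cast_nonneg _
      have hP1 : 1 ≤ P := Real.one_le_rpow hn1.le (by linarith)
      nlinarith
    · rw [hm, hmin]
      have hiR : (S.card : ℝ) ≤ n * A.card := by exact_mod_cast hi
      calc (S.card : ℝ) ≤ n * A.card := hiR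
        _ = P * x := by rw [hx, ← hPQ]; ring
        _ ≤ P * (2 * M) := mul_le_mul_of_nonneg_left hMx hP0.le
        _ = 2 * P * M := by ring
  · -- the bump: n^{1/2+ε} |S'| < n |A| ≤ n |S' ∩ U_{i→l}|
    have hfil : A.card ≤ (S'.filter (fun σ => σ i = l)).card := by
      refine Finset.card_le_card (fun σ hσ => ?_)
      rw [Finset.mem_filter]
      exact ⟨hAS' hσ, (Finset.mem_filter.1 hσ).2⟩
    have hfilR : (A.card : ℝ) ≤ (S'.filter (fun σ => σ i = l)).card := by exact_mod_cast hfil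
    have hmR : (S'.card : ℝ) ≤ M := by rw [hcard]; exact_mod_cast hmM
    calc P * (S'.card : ℝ) ≤ P * M := mul_le_mul_of_nonneg_left hmR hP0.le
      _ < P * x := mul_lt_mul_of_pos_left hMlt hP0
      _ = n * A.card := by rw [hx, ← hPQ]; ring
      _ ≤ n * ((S'.filter (fun σ => σ i = l)).card : ℝ) :=
          mul_le_mul_of_nonneg_left hfilR hn0.le

/-- **`JuntaBranch ⇒ WindowRegularity`** (the statement `PartialSliceNecessity` of round-2
ideator 4, memo §4 lemma L1, with `WindowRegularity ε c` inlined verbatim): if the crux holds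
then for all `0 < ε < 1/2` and `c > 0`, eventually every TPP triple of `S_n` of volume
`≥ 4n^{1/2+ε}(n!)^{3/2}e^{-c√n}` is beaten, at some level `n' ∈ [n-√n, n)`, by a TPP triple with
`e^{c+1}|S||T||U|(n'!/n!)^{3/2} ≤ 4n^{1/2+ε}|S'||T'||U'|`.  Proof: apply the crux at `(ε, c)` to
the partial slice of `exists_partialSlice` (TPP by heredity, `Large(c)` since the slice keeps a
`1/(2n^{1/2+ε})` fraction of the volume, bumpy at level `t = 1` by construction). -/
theorem juntaBranch_imp_windowRegularity :
    JuntaBranch → ∀ ε : ℝ, 0 < ε → ε < 1 / 2 → ∀ c : ℝ, 0 < c →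
      ∃ n₀ : ℕ, ∀ n ≥ n₀, ∀ S T U : Finset (Equiv.Perm (Fin n)), TripleProductProperty S T U →
        4 * (n : ℝ) ^ (1 / 2 + ε) * ((n.factorial : ℝ) ^ ((3 : ℝ) / 2) *
            Real.exp (-(c * Real.sqrt (n : ℝ)))) ≤ ((S.card * T.card * U.card : ℕ) : ℝ) →
        ∃ n' : ℕ, (n : ℝ) - Real.sqrt (n : ℝ) ≤ (n' : ℝ) ∧ n' < n ∧
          ∃ S' T' U' : Finset (Equiv.Perm (Fin n')), TripleProductProperty S' T' U' ∧
            Real.exp (c + 1) * ((S.card * T.card * U.card : ℕ) : ℝ) *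
                ((n'.factorial : ℝ) / (n.factorial : ℝ)) ^ ((3 : ℝ) / 2) ≤
              4 * (n : ℝ) ^ (1 / 2 + ε) * ((S'.card * T'.card * U'.card : ℕ) : ℝ) := by
  intro hJB ε hε hε2 c hc
  obtain ⟨n₂, hJ⟩ := hJB ε hε c hc
  refine ⟨max n₂ 2, fun n hn S T U hTPP hV => ?_⟩
  have hn₂ : n₂ ≤ n := le_of_max_le_left hn
  have hn2 : 2 ≤ n := le_of_max_le_right hn
  have hn1 : 1 ≤ n := le_trans (by norm_num) hn2
  have hn0 : (0 : ℝ) < n := by exact_mod_cast (lt_of_lt_of_le (by norm_num) hn1)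
  set P : ℝ := (n : ℝ) ^ (1 / 2 + ε) with hP
  have hP0 : 0 < P := Real.rpow_pos_of_pos hn0 _
  set Lf : ℝ := (n.factorial : ℝ) ^ ((3 : ℝ) / 2) * Real.exp (-(c * Real.sqrt (n : ℝ))) with hLf
  have hLf0 : 0 < Lf := by positivity
  -- S is non-empty
  have hV0 : (0 : ℝ) < ((S.card * T.card * U.card : ℕ) : ℝ) :=
    lt_of_lt_of_le (by positivity) hV
  have hV0' : 0 < S.card * T.card * U.card := by exact_mod_cast hV0
  have hSpos : 0 < S.card := by
    rcases Nat.eq_zero_or_pos S.card with h0 | h0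
    · rw [h0] at hV0'; simp at hV0'
    · exact h0
  -- the partial slice at the target 0
  obtain ⟨i, S', hS'S, hvol, hbump⟩ :=
    exists_partialSlice hn2 hε hε2 ⟨0, hn1⟩ S (Finset.card_pos.1 hSpos)
  have hTPP' : TripleProductProperty S' T U := hTPP.mono hS'S subset_rfl subset_rfl
  -- volume comparison V ≤ 2P · V'
  have hTU : (0 : ℝ) ≤ ((T.card * U.card : ℕ) : ℝ) := Nat.cast_nonneg _
  have hVV : ((S.card * T.card * U.card : ℕ) : ℝ) ≤
      2 * P * ((S'.card * T.card * U.card : ℕ) : ℝ) := by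
    have e1 : ((S.card * T.card * U.card : ℕ) : ℝ) = (S.card : ℝ) * ((T.card * U.card : ℕ) : ℝ) := by
      push_cast; ring
    have e2 : 2 * P * ((S'.card * T.card * U.card : ℕ) : ℝ) =
        (2 * P * (S'.card : ℝ)) * ((T.card * U.card : ℕ) : ℝ) := by
      push_cast; ring
    rw [e1, e2]
    exact mul_le_mul_of_nonneg_right hvol hTU
  -- Large(c) for the slice: 4 P Lf ≤ V ≤ 2 P V'  ⇒  Lf ≤ 2 Lf ≤ V'
  have hLarge' : Lf ≤ ((S'.card * T.card * U.card : ℕ) : ℝ) := by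
    have h1 : 2 * P * (2 * Lf) ≤ 2 * P * ((S'.card * T.card * U.card : ℕ) : ℝ) := by
      calc 2 * P * (2 * Lf) = 4 * P * Lf := by ring
        _ ≤ _ := hV
        _ ≤ _ := hVV
    have h2 : 2 * Lf ≤ ((S'.card * T.card * U.card : ℕ) : ℝ) :=
      le_of_mul_le_mul_left h1 (by positivity)
    linarith
  -- the bump of the slice at level 1
  have hb : ∃ X : Finset (Equiv.Perm (Fin n)), (X = S' ∨ X = T ∨ X = U) ∧
      ∃ t : ℕ, 1 ≤ t ∧ (t : ℝ) ≤ Real.sqrt (n : ℝ) ∧ ∃ I L : Fin t → Fin n,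
        Function.Injective I ∧ Function.Injective L ∧
        (n : ℝ) ^ ((1 / 2 + ε) * t) * (X.card : ℝ) <
          ((X.filter (fun σ => ∀ k, σ (I k) = L k)).card : ℝ) * (n.descFactorial t : ℝ) := by
    refine ⟨S', Or.inl rfl, 1, le_rfl, ?_, fun _ => i, fun _ => ⟨0, hn1⟩,
      Function.injective_of_subsingleton _, Function.injective_of_subsingleton _, ?_⟩
    · rw [Nat.cast_one, Real.le_sqrt (by norm_num) (Nat.cast_nonneg n)]
      have : (1 : ℝ) ≤ n := by exact_mod_cast hn1
      linarith
    · have hfilt : S'.filter (fun σ => ∀ _k : Fin 1, σ i = ⟨0, hn1⟩) =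
          S'.filter (fun σ => σ i = ⟨0, hn1⟩) := by
        apply Finset.filter_congr
        intro σ _
        exact ⟨fun h => h 0, fun h _ => h⟩
      rw [hfilt, Nat.descFactorial_one, Nat.cast_one, mul_one]
      rw [mul_comm ((S'.filter (fun σ => σ i = ⟨0, hn1⟩)).card : ℝ)]
      simpa [hP] using hbump
  -- apply the crux to the slice and undo the slicing loss
  obtain ⟨n', h1, h2, S'', T'', U'', hTPP'', hle⟩ := hJ n hn₂ S' T U hTPP' hLarge' hb
  refine ⟨n', h1, h2, S'', T'', U'', hTPP'', ?_⟩
  have hr : 0 ≤ ((n'.factorial : ℝ) / (n.factorial : ℝ)) ^ ((3 : ℝ) / 2) := by positivity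
  have he : 0 ≤ Real.exp (c + 1) := (Real.exp_pos _).le
  have hW : (0 : ℝ) ≤ ((S''.card * T''.card * U''.card : ℕ) : ℝ) := Nat.cast_nonneg _
  calc Real.exp (c + 1) * ((S.card * T.card * U.card : ℕ) : ℝ) *
        ((n'.factorial : ℝ) / (n.factorial : ℝ)) ^ ((3 : ℝ) / 2)
      ≤ Real.exp (c + 1) * (2 * P * ((S'.card * T.card * U.card : ℕ) : ℝ)) *
          ((n'.factorial : ℝ) / (n.factorial : ℝ)) ^ ((3 : ℝ) / 2) :=
        mul_le_mul_of_nonneg_right (mul_le_mul_of_nonneg_left hVV he) hr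
    _ = 2 * P * (Real.exp (c + 1) * ((S'.card * T.card * U.card : ℕ) : ℝ) *
          ((n'.factorial : ℝ) / (n.factorial : ℝ)) ^ ((3 : ℝ) / 2)) := by ring
    _ ≤ 2 * P * ((S''.card * T''.card * U''.card : ℕ) : ℝ) :=
        mul_le_mul_of_nonneg_left hle (by positivity)
    _ ≤ 4 * P * ((S''.card * T''.card * U''.card : ℕ) : ℝ) := by nlinarith

end Summit.MatrixMultiplication.MatrixMultiplication.Theorems.JuntaBranch
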